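import Mathlib.Analysis.Analytic.Uniqueness
import Mathlib.Analysis.Analytic.Constructions
import Mathlib.Analysis.Complex.Basic
import Mathlib.Analysis.Convex.PathConnected
import Mathlib.Topology.MetricSpace.Thickening
import Mathlib.Topology.Order.IntermediateValue
import HarnessLib

/-!
# Real and positive units of monomial-times-unit functions near the closed unit cube

When a complex-valued real-analytic function near the closed cube `[0,1]ᵈ ⊆ ℝᵈ` has been written
as a monomial times a unit, `f(σ) = (∏ σ_i^{b_i}) · u(σ)` with `u` analytic and nowhere zero (the
output shape of divisor lemmas for normal-crossing discriminants), realness / positivity of `f` on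
the open cube propagates to the unit on a whole box neighbourhood of the closed cube:

* `exists_box_subset` — an open set containing `[0,1]ᵈ` contains an open box `(−δ, 1+δ)ᵈ`
  (compactness), which is convex, hence preconnected;
* `im_eq_zero_on_box_of_monomial_mul` — if `f` is real where the monomial does not vanish, then
  `u` is real on the box (identity principle for `im u`);
* `re_pos_on_box_of_monomial_mul` — if moreover `re f > 0` on the open cube then `re u > 0` on the
  box (intermediate value theorem);
* `im_eq_monomial_mul_of_sub_conj` — if `ζ − conj ζ = (∏ σ_i^{b_i}) · u` then
  `im ζ = (∏ σ_i^{b_i}) · v` on the box with `v = re (u / 2i)` real-analytic and nowhere zero.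

## References

* E. Bierstone, P. Milman, Publ. Math. IHÉS 67 (1988), §4; J. Kollár, *Lectures on Resolution of
  Singularities* (2007), §2.3 (units after monomialisation).
-/

noncomputable section

open Set Filter
open scoped Topology ComplexConjugate

namespace Literature.Analysis.Calculus

variable {d : ℕ}

/-- **Boxes around the closed cube.** An open subset of `ℝᵈ` containing the closed unit cube
contains an open box `(−δ, 1 + δ)ᵈ`, `δ > 0`. [folklore] -/
theorem exists_box_subset {V : Set (Fin d → ℝ)} (hV : IsOpen V)
    (hcube : Set.pi Set.univ (fun _ : Fin d => Icc (0 : ℝ) 1) ⊆ V) :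
    ∃ δ : ℝ, 0 < δ ∧ Set.pi Set.univ (fun _ : Fin d => Ioo (-δ) (1 + δ)) ⊆ V := by
  obtain ⟨δ, hδ, hthick⟩ := (isCompact_univ_pi fun _ : Fin d => isCompact_Icc).exists_thickening_subset_open
    hV hcube
  refine ⟨δ, hδ, fun x hx => hthick (Metric.mem_thickening_iff.2 ?_)⟩
  refine ⟨fun i => max 0 (min 1 (x i)), fun i _ => ⟨le_max_left _ _, max_le zero_le_one (min_le_left _ _)⟩,
    ?_⟩
  rcases Nat.eq_zero_or_pos d with hd | hd
  · subst hd
    rw [Subsingleton.elim x (fun i => max 0 (min 1 (x i)))]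
    simpa using hδ
  · haveI : Nonempty (Fin d) := ⟨⟨0, hd⟩⟩
    refine (dist_pi_lt_iff hδ).2 fun i => ?_
    have h := hx i (mem_univ _)
    rw [Real.dist_eq, abs_lt]
    constructor
    · rcases le_total (x i) 1 with h1 | h1
      · rw [min_eq_right h1]
        rcases le_total 0 (x i) with h0 | h0
        · rw [max_eq_right h0]; linarith
        · rw [max_eq_left h0]; linarith [h.1]
      · rw [min_eq_left h1, max_eq_right zero_le_one]; linarith
    · rcases le_total (x i) 1 with h1 | h1
      · rw [min_eq_right h1]
        rcases le_total 0 (x i) with h0 | h0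
        · rw [max_eq_right h0]; linarith
        · rw [max_eq_left h0]; linarith
      · rw [min_eq_left h1, max_eq_right zero_le_one]; linarith [h.2]

/-- Open boxes are preconnected. [folklore] -/
theorem isPreconnected_box (a b : ℝ) :
    IsPreconnected (Set.pi Set.univ (fun _ : Fin d => Ioo a b)) :=
  (convex_pi fun _ _ => convex_Ioo a b).isPreconnected

/-- The closed unit cube lies in every box `(−δ, 1 + δ)ᵈ`, `δ > 0`. [folklore] -/
theorem pi_Icc_subset_box {δ : ℝ} (hδ : 0 < δ) :
    Set.pi Set.univ (fun _ : Fin d => Icc (0 : ℝ) 1) ⊆ Set.pi Set.univ (fun _ : Fin d => Ioo (-δ) (1 + δ)) :=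
  Set.pi_mono fun _ _ x hx => ⟨by linarith [hx.1], by linarith [hx.2]⟩

/-- The open unit cube lies in every box `(−δ, 1 + δ)ᵈ`, `δ > 0`. [folklore] -/
theorem pi_Ioo_subset_box {δ : ℝ} (hδ : 0 < δ) :
    Set.pi Set.univ (fun _ : Fin d => Ioo (0 : ℝ) 1) ⊆ Set.pi Set.univ (fun _ : Fin d => Ioo (-δ) (1 + δ)) :=
  Set.pi_mono fun _ _ x hx => ⟨by linarith [hx.1], by linarith [hx.2]⟩

/-- The subset of a box where no coordinate vanishes is open and non-empty. [folklore] -/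
theorem isOpen_box_inter_forall_ne_zero (δ : ℝ) :
    IsOpen (Set.pi Set.univ (fun _ : Fin d => Ioo (-δ) (1 + δ)) ∩ {σ | ∀ i, σ i ≠ 0}) := by
  refine (isOpen_set_pi finite_univ fun _ _ => isOpen_Ioo).inter ?_
  have : {σ : Fin d → ℝ | ∀ i, σ i ≠ 0} = ⋂ i, {σ | σ i ≠ 0} := by ext; simp
  rw [this]
  exact isOpen_iInter_of_finite fun i => isOpen_ne_fun (continuous_apply i) continuous_const

/-- **Realness of the unit.** Let `u` be real-analytic on the box `B = (−δ, 1+δ)ᵈ` and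
`f = (∏ σ_i^{b_i}) · u` on `B`. If `f` is real at the points of `B` with all coordinates non-zero,
then `u` is real on all of `B` (identity principle for `im u`). [folklore] -/
theorem im_eq_zero_on_box_of_monomial_mul {δ : ℝ} (hδ : 0 < δ) {f u : (Fin d → ℝ) → ℂ}
    {b : Fin d → ℕ} (hu : AnalyticOnNhd ℝ u (Set.pi Set.univ (fun _ : Fin d => Ioo (-δ) (1 + δ))))
    (hf : ∀ σ ∈ Set.pi Set.univ (fun _ : Fin d => Ioo (-δ) (1 + δ)),
      f σ = (∏ i, ((σ i : ℝ) : ℂ) ^ b i) * u σ)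
    (hreal : ∀ σ ∈ Set.pi Set.univ (fun _ : Fin d => Ioo (-δ) (1 + δ)), (∀ i, σ i ≠ 0) → (f σ).im = 0) :
    ∀ σ ∈ Set.pi Set.univ (fun _ : Fin d => Ioo (-δ) (1 + δ)), (u σ).im = 0 := by
  set B := Set.pi Set.univ (fun _ : Fin d => Ioo (-δ) (1 + δ)) with hB
  have him : AnalyticOnNhd ℝ (fun σ => (u σ).im) B := fun σ hσ =>
    (Complex.imCLM.analyticAt _).comp (hu σ hσ)
  -- the centre of the cube has non-zero coordinates
  set σ₀ : Fin d → ℝ := fun _ => 2⁻¹ with hσ₀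
  have hσ₀B : σ₀ ∈ B ∩ {σ | ∀ i, σ i ≠ 0} :=
    ⟨fun i _ => ⟨by norm_num [hσ₀]; linarith, by norm_num [hσ₀]; linarith⟩, fun i => by norm_num [hσ₀]⟩
  have hzero : ∀ σ ∈ B ∩ {σ | ∀ i, σ i ≠ 0}, (u σ).im = 0 := by
    intro σ hσ
    have hmono : (∏ i, ((σ i : ℝ) : ℂ) ^ b i) ≠ 0 :=
      Finset.prod_ne_zero_iff.2 fun i _ => pow_ne_zero _ (Complex.ofReal_ne_zero.2 (hσ.2 i))
    have hu' : u σ = f σ / ∏ i, ((σ i : ℝ) : ℂ) ^ b i := by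
      rw [hf σ hσ.1, mul_div_cancel_left₀ _ hmono]
    have hprod : (∏ i, ((σ i : ℝ) : ℂ) ^ b i) = ((∏ i, σ i ^ b i : ℝ) : ℂ) := by push_cast; rfl
    rw [hu', hprod, Complex.div_ofReal_im, hreal σ hσ.1 hσ.2, zero_div]
  have h := him.eqOn_zero_of_preconnected_of_eventuallyEq_zero (isPreconnected_box _ _) hσ₀B.1
    (eventually_of_mem ((isOpen_box_inter_forall_ne_zero δ).mem_nhds hσ₀B) hzero)
  exact fun σ hσ => h hσ

/-- **Positivity of the unit.** In the situation of `im_eq_zero_on_box_of_monomial_mul`, if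
moreover `re f > 0` on the open unit cube then `re u > 0` on the whole box (the unit has no zeros,
is real, and is positive somewhere; intermediate value theorem on the preconnected box).
[folklore] -/
theorem re_pos_on_box_of_monomial_mul {δ : ℝ} (hδ : 0 < δ) {f u : (Fin d → ℝ) → ℂ}
    {b : Fin d → ℕ} (hu : AnalyticOnNhd ℝ u (Set.pi Set.univ (fun _ : Fin d => Ioo (-δ) (1 + δ))))
    (hu0 : ∀ σ ∈ Set.pi Set.univ (fun _ : Fin d => Ioo (-δ) (1 + δ)), u σ ≠ 0)
    (hf : ∀ σ ∈ Set.pi Set.univ (fun _ : Fin d => Ioo (-δ) (1 + δ)),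
      f σ = (∏ i, ((σ i : ℝ) : ℂ) ^ b i) * u σ)
    (hreal : ∀ σ ∈ Set.pi Set.univ (fun _ : Fin d => Ioo (-δ) (1 + δ)), (∀ i, σ i ≠ 0) → (f σ).im = 0)
    (hpos : ∀ σ ∈ Set.pi Set.univ (fun _ : Fin d => Ioo (0 : ℝ) 1), 0 < (f σ).re) :
    ∀ σ ∈ Set.pi Set.univ (fun _ : Fin d => Ioo (-δ) (1 + δ)), (u σ).im = 0 ∧ 0 < (u σ).re := by
  set B := Set.pi Set.univ (fun _ : Fin d => Ioo (-δ) (1 + δ)) with hB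
  have him := im_eq_zero_on_box_of_monomial_mul hδ hu hf hreal
  have hre : ContinuousOn (fun σ => (u σ).re) B := fun σ hσ =>
    ((Complex.reCLM.analyticAt _).comp (hu σ hσ)).continuousAt.continuousWithinAt
  have hne : ∀ σ ∈ B, (u σ).re ≠ 0 := fun σ hσ h =>
    hu0 σ hσ (Complex.ext h (him σ hσ))
  set σ₀ : Fin d → ℝ := fun _ => 2⁻¹ with hσ₀
  have hσ₀O : σ₀ ∈ Set.pi Set.univ (fun _ : Fin d => Ioo (0 : ℝ) 1) :=
    fun i _ => ⟨by norm_num [hσ₀], by norm_num [hσ₀]⟩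
  have hσ₀B : σ₀ ∈ B := pi_Ioo_subset_box hδ hσ₀O
  have hpos₀ : 0 < (u σ₀).re := by
    have hmono : (∏ i, ((σ₀ i : ℝ) : ℂ) ^ b i) = ((∏ i, σ₀ i ^ b i : ℝ) : ℂ) := by push_cast; rfl
    have hmpos : 0 < ∏ i, σ₀ i ^ b i :=
      Finset.prod_pos fun i _ => pow_pos (hσ₀O i (mem_univ _)).1 _
    have h := hpos σ₀ hσ₀O
    rw [hf σ₀ hσ₀B, hmono, Complex.re_ofReal_mul] at h
    exact pos_of_mul_pos_right h hmpos.le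
  intro σ hσ
  refine ⟨him σ hσ, ?_⟩
  by_contra h
  push Not at h
  obtain ⟨x, hx, hx0⟩ := (isPreconnected_box (-δ) (1 + δ)).intermediate_value hσ hσ₀B hre ⟨h, hpos₀.le⟩
  exact hne x hx hx0

/-- **Imaginary parts as monomials times real units.** If `ζ − conj ζ = (∏ σ_i^{b_i}) · u` on the
box `B = (−δ, 1+δ)ᵈ` with `u` real-analytic and nowhere zero on `B`, then
`im ζ = (∏ σ_i^{b_i}) · v` on `B` for a real-analytic, real, nowhere vanishing `v` (`v = u / 2i`).
[folklore] -/
theorem im_eq_monomial_mul_of_sub_conj {δ : ℝ} (hδ : 0 < δ) {ζ u : (Fin d → ℝ) → ℂ}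
    {b : Fin d → ℕ} (hu : AnalyticOnNhd ℝ u (Set.pi Set.univ (fun _ : Fin d => Ioo (-δ) (1 + δ))))
    (hu0 : ∀ σ ∈ Set.pi Set.univ (fun _ : Fin d => Ioo (-δ) (1 + δ)), u σ ≠ 0)
    (hsub : ∀ σ ∈ Set.pi Set.univ (fun _ : Fin d => Ioo (-δ) (1 + δ)),
      ζ σ - conj (ζ σ) = (∏ i, ((σ i : ℝ) : ℂ) ^ b i) * u σ) :
    ∃ v : (Fin d → ℝ) → ℝ, AnalyticOnNhd ℝ v (Set.pi Set.univ (fun _ : Fin d => Ioo (-δ) (1 + δ))) ∧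
      (∀ σ ∈ Set.pi Set.univ (fun _ : Fin d => Ioo (-δ) (1 + δ)), v σ ≠ 0) ∧
      ∀ σ ∈ Set.pi Set.univ (fun _ : Fin d => Ioo (-δ) (1 + δ)), (ζ σ).im = (∏ i, σ i ^ b i) * v σ := by
  set B := Set.pi Set.univ (fun _ : Fin d => Ioo (-δ) (1 + δ)) with hB
  -- `f = im ζ` (as a complex number) and the unit `u / (2 I)`
  set u' : (Fin d → ℝ) → ℂ := fun σ => u σ / (2 * Complex.I) with hu'
  have h2I : (2 * Complex.I) ≠ 0 := mul_ne_zero two_ne_zero Complex.I_ne_zero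
  have hu'a : AnalyticOnNhd ℝ u' B := fun σ hσ => (hu σ hσ).div analyticAt_const h2I
  have hu'0 : ∀ σ ∈ B, u' σ ≠ 0 := fun σ hσ => div_ne_zero (hu0 σ hσ) h2I
  have hf : ∀ σ ∈ B, ((ζ σ).im : ℂ) = (∏ i, ((σ i : ℝ) : ℂ) ^ b i) * u' σ := fun σ hσ => by
    rw [hu']
    simp only
    rw [mul_div_assoc', ← hsub σ hσ, Complex.sub_conj]
    field_simp
    push_cast
    ring
  have him := im_eq_zero_on_box_of_monomial_mul hδ hu'a hf (fun σ _ _ => Complex.ofReal_im _)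
  refine ⟨fun σ => (u' σ).re, fun σ hσ => (Complex.reCLM.analyticAt _).comp (hu'a σ hσ),
    fun σ hσ h => hu'0 σ hσ (Complex.ext h (him σ hσ)), fun σ hσ => ?_⟩
  have hmono : (∏ i, ((σ i : ℝ) : ℂ) ^ b i) = ((∏ i, σ i ^ b i : ℝ) : ℂ) := by push_cast; rfl
  have h := congrArg Complex.re (hf σ hσ)
  rwa [Complex.ofReal_re, hmono, Complex.re_ofReal_mul] at h

end Literature.Analysis.Calculus
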